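import Literature.Barriers.PneNP.MatchingSlackPsdFoolingSet
import Literature.Barriers.PneNP.PerfectMatchingExtensionComplexity
import Literature.Combinatorics.Optimization.PatternMatrixRankUpperBounds
import HarnessLib

/-!
# Barrier: rectangle-covering (support-based nonnegative-rank) arguments certify at most `C(n,2)² ≤ n⁴`
# for Edmonds' matching polytope (Yannakakis 1991, Cor. 4 and p. 459; Fiorini–Kaibel–Pashkovich–Theis 2013, Lemma 16)

M. Yannakakis, *Expressing combinatorial optimization problems by linear programs*, J. Comput. System
Sci. 43 (1991) 441–466 [Yannakakis1991] (held, `paper:doi-10-1145-62212-62232`, journal pagination),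
§4, p. 459, verbatim: "COROLLARY 4. The nondeterministic communication complexity of the predicate FV
is a lower bound on the logarithm of the minimum size of an LP expressing the polytope. For the
matching polytope there is an obvious 4 log n nondeterministic protocol: just guess two edges of the
matching that cross the partition of the facet. Thus, in the case of the matching polytope, the
corollary cannot give a lower bound better than `n⁴`, which is probably (we believe) far from tight."
S. Fiorini, V. Kaibel, K. Pashkovich, D. O. Theis, *Combinatorial bounds on nonnegative rank and
extended formulations*, Discrete Math. 313 (2013) 67–83 = arXiv:1111.0444
[FioriniKaibelPashkovichTheis2013] (held, `paper:arxiv-1111.0444`), §3.1, verbatim: "A facet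
corresponding to some odd set `S` and a vertex corresponding to some matching are non-incident if and
only if the matching has more than one edge in `δ(S)`. Lemma 16. The rectangle covering number
`rc(P_PM(n))` is `O(n⁴)`. Proof. … the non-zero entries corresponding to the odd-subset inequalities
can be covered by `O(n⁴)` 1-rectangles [Yannakakis91]. For this one considers the rectangles
`R_{e₁,e₂} = I_{e₁,e₂} × J_{e₁,e₂}` indexed by unordered pair of edges `e₁, e₂`, where the set
`I_{e₁,e₂}` consists of all odd sets `S` such that `e₁, e₂ ∈ δ(S)` and the set `J_{e₁,e₂}` consists
of all the matchings containing both edges `e₁, e₂`. □ Thus in the case of `P_PM(n)` we cannot obtain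
any lower bound better than `O(n⁴)` solely by reasoning on rectangle coverings." and §6: "it would be
interesting to know the rectangle covering bound of the perfect matching polytope. As mentioned
above, it is `O(n⁴)`. Even a small improvement on the trivial lower bound `Ω(n²)` would be
interesting."

This file is the NONNEGATIVE-RANK companion of `MatchingSlackPsdSupportBarrier.lean` /
`MatchingSlackPsdFoolingSet.lean` (the psd version, FGPRT §5.2) on the same object, the odd-cut slack
matrix `S_{UM} = |δ(U) ∩ M| − 1` of the perfect matching polytope of `K_n` (`pmOddCutSlack n`, rows
`OddSet n`, columns `PMatch n`), and PROVES (no named fact):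

* `IsSupportBasedNonnegBound n R` — the TECHNIQUE CLASS: `R` is certified by a support-based
  (zero-pattern) argument iff every entrywise nonnegative matrix with the same zero pattern as `S` has
  no nonnegative factorisation of size `< R`. Rectangle-covering bounds (`rk₊ ≥ rc`, FMPTW Thm. 4 /
  Yannakakis Cor. 4, the nondeterministic communication complexity of the support), fooling sets and
  every other bound that reads only the support certify exactly such `R` — the minimum of `rk₊` over the
  nonnegative matrices of a given support is its rectangle covering number (see `scope_caveats`);
* `pmOddCutSlack_ne_zero_iff` — "non-incident iff the matching has more than one edge in `δ(S)`": the
  support of `S` is COVERED by the rectangles `R_{e₁,e₂} = {U : e₁, e₂ ∈ δ(U)} × {M : e₁, e₂ ∈ M}`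
  (`e₁ ≠ e₂` non-loop edges of `K_n`), each of which lies inside the support ("guess two edges of the
  matching that cross the partition");
* `pairCoverMatrix n = Σ_{e₁ ≠ e₂} 𝟙_{R_{e₁,e₂}}` has the zero pattern of `S`
  (`pairCoverMatrix_eq_zero_iff`) and a nonnegative factorisation of size `C(n,2)²`
  (`hasNonnegFactorization_pairCoverMatrix`; ordered pairs, so twice the printed `C(C(n,2),2)` — both
  are `O(n⁴)`);
* `supportBasedNonnegBound_le` — the BARRIER: every support-based nonnegative-rank lower bound for
  Edmonds' odd-cut slack matrix satisfies `R ≤ C(n,2)²`, hence `R ≤ n⁴`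
  (`supportBasedNonnegBound_le_pow_four`); through the tree's Yannakakis direction
  `hasNonnegFactorization_pmOddCutSlack_of_hasEF` (an EF of size `r` gives `rk₊(S) ≤ r + 1`) this is
  Corollary 4's ceiling "cannot give a lower bound better than `n⁴`" for `xc(P_PM(n))`;
* the WINDOW (`supportBasedNonneg_window`): support-based arguments DO certify `C(n/2 − 1, 2) ≈ n²/8`
  (`isSupportBasedNonnegBound_even`, from the tree's psd fooling set — a nonnegative factorisation is a
  psd one with diagonal factors) and never more than `C(n,2)²`; FKPT's open question (§6) is where in
  `[Ω(n²), O(n⁴)]` the rectangle covering number of `P_PM(n)` lies.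

technique_class: support-based nonnegative-rank / extension-complexity lower bounds for the matching
  polytope — rectangle covering number, nondeterministic communication complexity of the slack support
  (Yannakakis Cor. 4), fooling sets, and any bound valid for every nonnegative matrix with the zero
  pattern of `S` (`IsSupportBasedNonnegBound`). [cite: Yannakakis1991, Cor. 4 (p. 459)] [cite: FioriniKaibelPashkovichTheis2013, §3.1 Lemma 16]
blocks: any lower bound on `rk₊(S_odd(K_n))`, hence on `xc(P_PM(n))`, exceeding `C(n,2)² ≤ n⁴` by such
  arguments — in particular they cannot reach Rothvoß's `2^{Ω(n)}` (in the tree: `Rothvoss2017_thm1`).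
  [cite: Yannakakis1991, p. 459] [cite: FioriniKaibelPashkovichTheis2013, §3.1 ("we cannot obtain any lower bound better than O(n⁴) solely by reasoning on rectangle coverings")]
because: the support `{(U,M) : |δ(U) ∩ M| ≥ 2}` is the union of the `O(n⁴)` rectangles `R_{e₁,e₂}`, so
  the nonnegative matrix `Σ 𝟙_{R_{e₁,e₂}}` has the same support and nonnegative rank `≤ C(n,2)²`.
  [cite: Yannakakis1991, p. 459 ("guess two edges of the matching that cross the partition of the facet")] [cite: FioriniKaibelPashkovichTheis2013, Lemma 16 and its proof]
evasions_known: value-sensitive bounds — Rothvoß's hyperplane-separation lower bound `2^{Ω(n)}` for the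
  same matrix uses the entries `|δ(U) ∩ M| − 1`, not only their zero pattern (in the tree:
  `rothvoss_matching_slack_bound_holds`, `Rothvoss2017_thm1`). [cite: Rothvoss2017, Thm. 1 and §2 (hyperplane separation bound)]
scope_caveats: the sources bound the RECTANGLE COVERING NUMBER (`O(n⁴)`, including the degree and
  nonnegativity rows of Edmonds' system, which add `O(n²)` height-one rectangles); here only the odd-cut
  block is treated, with ordered pairs (`C(n,2)²` instead of `C(C(n,2),2)`), and the technique class is
  phrased as "valid for every nonnegative matrix with the same support", whose optimum IS the rectangle
  covering number (a cover by `d` rectangles gives the same-support matrix `Σ 𝟙_R` of `rk₊ ≤ d`;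
  conversely `rk₊ ≥ rc`); the exact value of `rc(P_PM(n))` in `[Ω(n²), O(n⁴)]` is open
  (FKPT §6). Nothing is said about `rk₊(S)` itself (which is `2^{Θ(n)}`). [cite: FioriniKaibelPashkovichTheis2013, §3.1 and §6]
status: established (both sources; everything below is proved).
-/

noncomputable section

open Finset

namespace Literature.Barriers.PneNP

open Literature.Combinatorics.Optimization (HasPsdFactorization HasNonnegFactorization
  hasNonnegFactorization_of_fintype)
open Literature.Combinatorics.SimpleGraph.CycleSpace (Crosses crosses_mk)
open PsdFoolingSet (one_le_cc pmOddCutSlack_eq_zero_iff pmOddCutSlack_nonneg isSupportBasedPsdBound_even)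

variable {n : ℕ}

/-! ### The technique class -/

/-- **Support-based nonnegative-rank lower bound** (the technique class of Yannakakis' Corollary 4 /
rectangle covering): `R` is certified for the odd-cut slack matrix `S` of `K_n` by a support-based
argument iff every entrywise nonnegative matrix `N` on `OddSet n × PMatch n` with the same zero pattern
as `S` admits no nonnegative factorisation of size `< R`.
[cite: Yannakakis1991, Cor. 4 (p. 459)] [cite: FioriniKaibelPashkovichTheis2013, §3.1] -/
def IsSupportBasedNonnegBound (n : ℕ) (R : ℕ) : Prop :=
  ∀ N : OddSet n → PMatch n → ℝ, (∀ U M, 0 ≤ N U M) →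
    (∀ U M, N U M = 0 ↔ pmOddCutSlack n U M = 0) → ∀ r : ℕ, r < R → ¬HasNonnegFactorization N r

/-- The class is monotone in `R`. [cite: Yannakakis1991, Cor. 4 (p. 459)] -/
theorem IsSupportBasedNonnegBound.mono {R R' : ℕ} (h : IsSupportBasedNonnegBound n R) (hR : R' ≤ R) :
    IsSupportBasedNonnegBound n R' :=
  fun N hN hsupp r hr => h N hN hsupp r (lt_of_lt_of_le hr hR)

/-- A support-based PSD-rank certificate is in particular a support-based nonnegative-rank certificate
(a nonnegative factorisation of size `r` is a psd factorisation of size `r` with diagonal factors).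
[cite: FawziEtAl2015, Prop. 2.5 (p05) and §5.2 (p15)] -/
theorem IsSupportBasedPsdBound.isSupportBasedNonnegBound {R : ℕ} (h : IsSupportBasedPsdBound n R) :
    IsSupportBasedNonnegBound n R := by
  intro N hN hsupp r hr hfac
  obtain ⟨U, V, hU, hV, hM⟩ := hfac
  exact h N hN hsupp r hr (HasPsdFactorization.of_nonnegFactorization U V hU hV hM)

/-! ### The support: "more than one edge in `δ(S)`", and its cover by the rectangles `R_{e₁,e₂}` -/

/-- A loop crosses no vertex set. [folklore] -/
private theorem not_isDiag_of_crosses (A : Finset (Fin n)) {e : Sym2 (Fin n)} (he : Crosses A e) :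
    ¬e.IsDiag := by
  induction e using Sym2.ind with
  | h x y =>
    rw [Sym2.mk_isDiag_iff]
    rintro rfl
    rw [crosses_mk] at he
    tauto

/-- **The support of Edmonds' slack matrix is covered by the rectangles `R_{e₁,e₂}`, each inside the
support**: `S_{UM} ≠ 0` iff there are two distinct (non-loop) edges `e₁ ≠ e₂` with `e₁, e₂ ∈ δ(U)` and
`e₁, e₂ ∈ M` ("non-incident if and only if the matching has more than one edge in `δ(S)`"; "just guess
two edges of the matching that cross the partition of the facet").
[cite: Yannakakis1991, p. 459] [cite: FioriniKaibelPashkovichTheis2013, §3.1, Lemma 16 (proof)] -/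
theorem pmOddCutSlack_ne_zero_iff (U : OddSet n) (M : PMatch n) :
    pmOddCutSlack n U M ≠ 0 ↔
      ∃ e₁ e₂ : Edge n, e₁ ≠ e₂ ∧ (Crosses U.1 e₁.1 ∧ Crosses U.1 e₂.1) ∧ (e₁.1 ∈ M.1 ∧ e₂.1 ∈ M.1) := by
  rw [Ne, pmOddCutSlack_eq_zero_iff]
  have h1 := one_le_cc U M
  constructor
  · intro hne
    have h2 : 1 < (M.1.filter (Crosses U.1)).card := by unfold cc at hne h1; omega
    obtain ⟨a, ha, b, hb, hab⟩ := Finset.one_lt_card.1 h2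
    obtain ⟨haM, haC⟩ := mem_filter.1 ha
    obtain ⟨hbM, hbC⟩ := mem_filter.1 hb
    refine ⟨⟨a, not_isDiag_of_crosses U.1 haC⟩, ⟨b, not_isDiag_of_crosses U.1 hbC⟩, ?_, ⟨haC, hbC⟩,
      ⟨haM, hbM⟩⟩
    intro h
    exact hab (congrArg Subtype.val h)
  · rintro ⟨e₁, e₂, hne, ⟨h₁, h₂⟩, ⟨hm₁, hm₂⟩⟩ hcc
    have h2 : 1 < (M.1.filter (Crosses U.1)).card :=
      Finset.one_lt_card.2 ⟨e₁.1, mem_filter.2 ⟨hm₁, h₁⟩, e₂.1, mem_filter.2 ⟨hm₂, h₂⟩,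
        fun h => hne (Subtype.ext h)⟩
    unfold cc at hcc
    omega

/-! ### The same-support matrix `Σ_{e₁ ≠ e₂} 𝟙_{R_{e₁,e₂}}` and its nonnegative rank -/

/-- The ordered pairs of distinct non-loop edges of `K_n` (the index set of the rectangles; ordered, so
each printed rectangle is counted twice). [cite: FioriniKaibelPashkovichTheis2013, §3.1, Lemma 16 (proof)] -/
abbrev EdgePair (n : ℕ) : Type := {p : Edge n × Edge n // p.1 ≠ p.2}

/-- `|EdgePair n| ≤ C(n,2)²`. [folklore] -/
private theorem card_edgePair_le (n : ℕ) : Fintype.card (EdgePair n) ≤ n.choose 2 ^ 2 := by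
  have hE : Fintype.card (Edge n) = n.choose 2 := by
    rw [Sym2.card_subtype_not_diag, Fintype.card_fin]
  calc Fintype.card (EdgePair n) ≤ Fintype.card (Edge n × Edge n) := Fintype.card_subtype_le _
    _ = n.choose 2 ^ 2 := by rw [Fintype.card_prod, hE, sq]

/-- Row indicator of the rectangle `R_{e₁,e₂}`: `𝟙[e₁, e₂ ∈ δ(U)]`. [cite: FioriniKaibelPashkovichTheis2013, §3.1, Lemma 16 (the sets I_{e₁,e₂})] -/
def pairRow (U : OddSet n) (p : EdgePair n) : ℝ :=
  if Crosses U.1 p.1.1.1 ∧ Crosses U.1 p.1.2.1 then 1 else 0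

/-- Column indicator of the rectangle `R_{e₁,e₂}`: `𝟙[e₁, e₂ ∈ M]`. [cite: FioriniKaibelPashkovichTheis2013, §3.1, Lemma 16 (the sets J_{e₁,e₂})] -/
def pairCol (p : EdgePair n) (M : PMatch n) : ℝ :=
  if p.1.1.1 ∈ M.1 ∧ p.1.2.1 ∈ M.1 then 1 else 0

variable (n) in
/-- The sum of the indicator matrices of the rectangles `R_{e₁,e₂}` over ordered pairs `e₁ ≠ e₂`:
`N_{UM} = #{(e₁,e₂) : e₁ ≠ e₂, e₁,e₂ ∈ δ(U) ∩ M}` — a nonnegative matrix built from the support alone.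
[cite: FioriniKaibelPashkovichTheis2013, §3.1, Lemma 16 (proof)] -/
def pairCoverMatrix (U : OddSet n) (M : PMatch n) : ℝ := ∑ p : EdgePair n, pairRow U p * pairCol p M

/-- The indicators are nonnegative. [folklore] -/
private theorem pairRow_nonneg (U : OddSet n) (p : EdgePair n) : 0 ≤ pairRow U p := by
  unfold pairRow; split_ifs <;> norm_num

/-- The indicators are nonnegative. [folklore] -/
private theorem pairCol_nonneg (p : EdgePair n) (M : PMatch n) : 0 ≤ pairCol p M := by
  unfold pairCol; split_ifs <;> norm_num

/-- `N` is entrywise nonnegative. [cite: FioriniKaibelPashkovichTheis2013, §3.1, Lemma 16 (proof)] -/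
theorem pairCoverMatrix_nonneg (U : OddSet n) (M : PMatch n) : 0 ≤ pairCoverMatrix n U M :=
  Finset.sum_nonneg fun p _ => mul_nonneg (pairRow_nonneg U p) (pairCol_nonneg p M)

/-- **`N` has a nonnegative factorisation of size `C(n,2)²`** (it is by definition a sum of
`|EdgePair n| ≤ C(n,2)²` nonnegative rank-one matrices). [cite: FioriniKaibelPashkovichTheis2013, §3.1, Lemma 16] -/
theorem hasNonnegFactorization_pairCoverMatrix (n : ℕ) :
    HasNonnegFactorization (pairCoverMatrix n) (n.choose 2 ^ 2) :=
  (hasNonnegFactorization_of_fintype (fun U p => pairRow U p) (fun p M => pairCol p M)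
    pairRow_nonneg pairCol_nonneg fun _ _ => rfl).mono (card_edgePair_le n)

/-- **`N` has exactly the zero pattern of Edmonds' slack matrix** (the rectangles cover the support
and lie inside it). [cite: Yannakakis1991, p. 459] [cite: FioriniKaibelPashkovichTheis2013, §3.1, Lemma 16 (proof)] -/
theorem pairCoverMatrix_eq_zero_iff (U : OddSet n) (M : PMatch n) :
    pairCoverMatrix n U M = 0 ↔ pmOddCutSlack n U M = 0 := by
  rw [← not_iff_not]
  change ¬pairCoverMatrix n U M = 0 ↔ pmOddCutSlack n U M ≠ 0
  rw [pmOddCutSlack_ne_zero_iff, pairCoverMatrix,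
    Finset.sum_eq_zero_iff_of_nonneg fun p _ => mul_nonneg (pairRow_nonneg U p) (pairCol_nonneg p M)]
  push Not
  constructor
  · rintro ⟨p, -, hp⟩
    have hr : pairRow U p ≠ 0 := fun h => hp (by rw [h, zero_mul])
    have hc : pairCol p M ≠ 0 := fun h => hp (by rw [h, mul_zero])
    unfold pairRow at hr
    unfold pairCol at hc
    rw [Ne, ite_eq_right_iff, Classical.not_imp] at hr hc
    exact ⟨p.1.1, p.1.2, p.2, hr.1, hc.1⟩
  · rintro ⟨e₁, e₂, hne, hcross, hmem⟩
    refine ⟨⟨(e₁, e₂), hne⟩, mem_univ _, ?_⟩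
    simp only [pairRow, pairCol, if_pos hcross, if_pos hmem, mul_one]
    exact one_ne_zero

/-! ### The barrier and the window -/

/-- **Barrier (Yannakakis 1991, p. 459; FKPT 2013, Lemma 16): support-based nonnegative-rank arguments
certify at most `C(n,2)²` for Edmonds' odd-cut slack matrix.** [cite: Yannakakis1991, Cor. 4 and p. 459] [cite: FioriniKaibelPashkovichTheis2013, §3.1, Lemma 16] -/
theorem supportBasedNonnegBound_le {R : ℕ} (h : IsSupportBasedNonnegBound n R) : R ≤ n.choose 2 ^ 2 := by
  by_contra hlt
  exact h (pairCoverMatrix n) pairCoverMatrix_nonneg pairCoverMatrix_eq_zero_iff (n.choose 2 ^ 2)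
    (lt_of_not_ge hlt) (hasNonnegFactorization_pairCoverMatrix n)

/-- `C(n,2)² ≤ n⁴`. [folklore] -/
private theorem choose_two_sq_le_pow_four (n : ℕ) : n.choose 2 ^ 2 ≤ n ^ 4 := by
  have h : n.choose 2 ≤ n ^ 2 := by
    rw [Nat.choose_two_right, sq]
    exact (Nat.div_le_self _ _).trans (Nat.mul_le_mul_left n (Nat.sub_le n 1))
  calc n.choose 2 ^ 2 ≤ (n ^ 2) ^ 2 := Nat.pow_le_pow_left h 2
    _ = n ^ 4 := by ring

/-- **"In the case of the matching polytope, the corollary cannot give a lower bound better than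
`n⁴`"**: every support-based nonnegative-rank certificate satisfies `R ≤ n⁴`. [cite: Yannakakis1991, p. 459] -/
theorem supportBasedNonnegBound_le_pow_four {R : ℕ} (h : IsSupportBasedNonnegBound n R) : R ≤ n ^ 4 :=
  (supportBasedNonnegBound_le h).trans (choose_two_sq_le_pow_four n)

/-- The lower end of the window, "the trivial lower bound `Ω(n²)`": for even `n`, support-based
arguments DO certify `C(n/2 − 1, 2)` — the tree's psd fooling set of that size in the odd-cut slack
matrix (`PsdFoolingSet.isSupportBasedPsdBound_even`) excludes every smaller psd factorisation of any
same-support nonnegative matrix, a fortiori every smaller nonnegative factorisation.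
[cite: FioriniKaibelPashkovichTheis2013, §6 ("the trivial lower bound Ω(n²)")] [cite: FawziEtAl2015, Thm. 2.10 + Ex. 2.11 (p07)] -/
theorem isSupportBasedNonnegBound_even (hn : Even n) : IsSupportBasedNonnegBound n ((n / 2 - 1).choose 2) :=
  (isSupportBasedPsdBound_even hn).isSupportBasedNonnegBound

/-- **The window of the technique class for Edmonds' slack matrix of `K_{2m}`**: support-based
nonnegative-rank arguments certify `C(m − 1, 2) ≈ n²/8` and never more than `C(2m, 2)² ≈ n⁴/4`
(FKPT §6: locating `rc(P_PM(n))` inside `[Ω(n²), O(n⁴)]` is open).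
[cite: FioriniKaibelPashkovichTheis2013, §3.1 Lemma 16 and §6] [cite: Yannakakis1991, p. 459] -/
theorem supportBasedNonneg_window (m : ℕ) :
    IsSupportBasedNonnegBound (2 * m) ((m - 1).choose 2) ∧
      ∀ R : ℕ, IsSupportBasedNonnegBound (2 * m) R → R ≤ (2 * m).choose 2 ^ 2 := by
  refine ⟨?_, fun R h => supportBasedNonnegBound_le h⟩
  have h := isSupportBasedNonnegBound_even (n := 2 * m) ⟨m, by ring⟩
  rwa [show 2 * m / 2 = m by omega] at h

/-- **Corollary 4's method, capped**: the Yannakakis direction "an extended formulation of `P_PM(n)` of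
size `r` yields a nonnegative factorisation of `S` of size `r + 1`" (the tree's
`hasNonnegFactorization_pmOddCutSlack_of_hasEF`) turns a support-based certificate `R` into
`xc(P_PM(n)) ≥ R − 1`; by the barrier such certificates stop at `R ≤ C(n,2)²`: the rectangle-covering
route proves `xc(P_PM(n)) ≥ R − 1` only for `R − 1 < C(n,2)² ≤ n⁴`.
[cite: Yannakakis1991, Cor. 4 and p. 459] [cite: FioriniKaibelPashkovichTheis2013, §3.1] -/
theorem supportBased_xc_method_capped {R r : ℕ} (h : IsSupportBasedNonnegBound n R)
    (hEF : HasEFOfSize (pmPolytope n) r) : R ≤ r + 1 ∧ R ≤ n.choose 2 ^ 2 := by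
  refine ⟨?_, supportBasedNonnegBound_le h⟩
  by_contra hlt
  exact h (pmOddCutSlack n) pmOddCutSlack_nonneg (fun _ _ => Iff.rfl) (r + 1) (lt_of_not_ge hlt)
    (hasNonnegFactorization_pmOddCutSlack_of_hasEF hEF)

end Literature.Barriers.PneNP
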